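import Literature.Barriers.MatrixMultiplication.UnstableTensorBarrierThm17
import Literature.Computability.AlgebraicComplexity.QuantumFunctionalsFree
import HarnessLib

/-!
# The `1`-degenerate minimal-border-rank tensors of `ℂ⁵ ⊗ ℂ⁵ ⊗ ℂ⁵` are unstable, hence irreversible

Topic `Literature/Barriers/MatrixMultiplication`; a REACH file for the catalogue entry
`UnstableTensorBarrier` (`UnstableTensorBarrier.lean`: Bläser–Lysikov 2020, Thm. 16 ∧ Thm. 17, both
proved in the tree, `UnstableTensorBarrierProofs.lean`). Everything here is PROVED (barrier audit
2026-08-16).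

## Why

The catalogue lists, after Bläser–Lysikov, three classes of starting tensors through which
`ω = 2` cannot be certified by restrictions of powers at bounded size: (a) unstable concise tensors,
(b) structure tensors of non-semisimple algebras, (c) BINDING tensors of minimal border rank
[cite: BlaserLysikov2020, Thm. 16, Cor. 24, Cor. 25]; Bläser–Lysikov add "We conjecture that not only
binding tensors, but all concise tensors of minimal border rank (except tensors equivalent to `⟨N⟩`)
are unstable" [cite: BlaserLysikov2020, §6 (p. 13, after Cor. 25)]. Jelisiejew–Landsberg–Pal
classify the concise `1`-degenerate (= not `1_*`-generic, in particular not binding) tensors of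
minimal border rank in `ℂ⁵ ⊗ ℂ⁵ ⊗ ℂ⁵`: up to `GL₅(ℂ)^{×3} ⋊ 𝔖₃` there are exactly five,
`T_{𝒪₅₈} ⊵ T_{𝒪₅₇} ⊵ T_{𝒪₅₆} ⊵ T_{𝒪₅₅} ⊵ T_{𝒪₅₄}` [cite: JelisiejewLandsbergPal2023, Thm. 1.6], and
propose such tensors for Strassen's laser method precisely because they fall outside class (c):
"new 'minimal cost' tensors for Strassen's laser method … that are not known to be subject to the
barriers … [BL20] shows there are barriers for minimal border rank binding tensors …, as our new
tensors are not binding" and "(At this writing there are no known laser method barriers for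
`1`-degenerate tensors.)" [cite: JelisiejewLandsbergPal2023, §1 and §1.4.8].

This file closes that would-be evasion at size `5`, inside class (a): each of the five tensors is
UNSTABLE — certified by an explicit diagonal one-parameter subgroup of `SL₅³` in the printed bases
(`isUnstable_jlpO58`, …, `isUnstable_jlpO54`) — and CONCISE (`isConcise_jlpO58`, …), so the proved
Thm. 17 applies: `B₁₇(5) · log Q̃(T) ≤ log R̃(T)` with `B₁₇(5) = (1 − 3⁻¹⁵/(18·5⁴·ln 5))⁻¹ > 1`
(`jlp_five_barrier`), i.e. `i(T) > 1`, and by BL Thm. 7 (= CVZ Thm. 9, `IrreversibilityBarrier.lean`)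
no bound `ω < 2·B₁₇(5)` — in particular not `ω = 2` — can be certified by arbitrary restrictions
from powers of any one of them.

## The general picture (not formalised here)

Bläser–Lysikov's conjecture holds in general, by a standard orbit-closure argument: `⟨N⟩` is
polystable, i.e. `SL_N(ℂ)³ · ⟨N⟩` is closed [cite: BurgisserIkenmeyer2017, Cor. 4.9]; a tensor of
border rank `≤ N` in `ℂ^{N×N×N}` lies in `cl(GL_N³ · ⟨N⟩) = cl(ℂ^× · SL_N³ · ⟨N⟩)`, say
`t = lim λ_k g_k ⟨N⟩`; since the closed orbit misses `0`, `|λ_k|` is bounded, and either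
`λ_k → λ ≠ 0` along a subsequence — then `g_k ⟨N⟩ → t/λ` lies in the closed orbit and `t ≅ ⟨N⟩` — or
`λ_k → 0`, and then every non-constant homogeneous `SL_N³`-invariant `f` has
`f(t) = lim λ_k^{deg f} f(⟨N⟩) = 0` [cite: BurgisserIkenmeyer2017, Prop. 3.9(1) (proof)], so `t`
lies in the null cone (Hilbert–Mumford: the null cone `{t | 0 ∈ cl(SL³·t)}` is the common zero set
of the non-constant homogeneous invariants)
[cite: BurgisserFranksGargOliveiraWalterWigderson2019, §1.3.4]. Hence EVERY concise tensor of
minimal border rank not equivalent to `⟨N⟩` is unstable, and class (c) of the catalogue needs no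
"binding" hypothesis. A Lean proof would need the closed-orbit theorem for the TRIPLE action (the
tree has the Kempf–Ness closedness theorem only for the diagonal tensor-power action,
`isClosed_tensorOrbit_of_critical`) and the invariant-theoretic description of the null cone; it is
not attempted here — the five explicit certificates below need neither.

## Content

* `isUnstable_of_sepWeight` — the easy half of the Hilbert–Mumford criterion in torus form (BL §2.3):
  real weights `x, y, z` of total sum `0` on the three index sets with `x a + y b + z c > 0` on
  `supp t` give the one-parameter subgroup `(diag e^{−s x}, diag e^{−s y}, diag e^{−s z}) ∈ SL³`
  driving `t` to `0`; integer form `isUnstable_intCast_of_sepWeight`.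
* `isConcise_intCast_of_dualCoords` (`linearIndependent_slices₁₂₃`) — conciseness of an integer
  table from dual coordinates for its three slice families.
* The five tensors `jlpO58, jlpO57, jlpO56, jlpO55, jlpO54 : Fin 5 → Fin 5 → Fin 5 → ℤ`
  (JLP Thm. 1.6, indices shifted to `0 … 4`), their instability with the weights
  `W₁ = ((8,−2,−2,−2,−2), (0,−10,5,5,0), (3,3,−2,−2,−2))` (for `𝒪₅₈, 𝒪₅₇`) and
  `W₂ = ((4,−1,−1,−1,−1), (−5,0,0,4,1), (2,2,−1,−1,−2))` (for `𝒪₅₆, 𝒪₅₅, 𝒪₅₄`), their conciseness,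
  and the Thm. 17 consequence `jlp_five_barrier`.

## Not here

* That the five tensors have border rank `5` (minimal) is JLP Thm. 1.6 and is not re-proved; it is
  not needed for the barrier, only for its interpretation.
* `Q̃(T) > 1` (each of the five restricts to `⟨2⟩`, e.g. on `a₁, a₅ / b₂, b₄ / c₂, c₅`), which would
  turn `jlp_five_barrier` into `Q̃(T) < R̃(T)` via `BlaserLysikov2020_thm17.subrank_lt_rank`, is
  left out.

## References

* M. Bläser, V. Lysikov, MFCS 2020, LIPIcs 170, 17: §2.3, Thm. 16, Thm. 17, Cor. 25 and the
  conjecture after it (p. 13). [BlaserLysikov2020]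
* J. Jelisiejew, J. M. Landsberg, A. Pal, *Concise tensors of minimal border rank*, Math. Ann.
  (2023), arXiv:2205.05713: Thm. 1.6 (the five tensors, `T_{M1}`, `T_{M2}`), §1, §1.4.8.
  [JelisiejewLandsbergPal2023]
* P. Bürgisser, C. Ikenmeyer, *Fundamental invariants of orbit closures*, J. Algebra 477 (2017):
  Prop. 3.9(1) and its proof, §4.2, Cor. 4.9. [BurgisserIkenmeyer2017]
* P. Bürgisser, C. Franks, A. Garg, R. Oliveira, M. Walter, A. Wigderson, FOCS 2019,
  arXiv:1910.12375, §1.3.4. [BurgisserFranksGargOliveiraWalterWigderson2019]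
-/

noncomputable section

open scoped BigOperators Matrix
open Filter Topology

namespace Literature.Barriers.MatrixMultiplication

open Literature.Computability.AlgebraicComplexity

/-! ## A combinatorial instability certificate: separating weights in a fixed basis -/

section SepWeight

variable {ι κ μ : Type} [Fintype ι] [Fintype κ] [Fintype μ] [DecidableEq ι] [DecidableEq κ]
  [DecidableEq μ]

/-- The diagonal matrix `diag(e^{−s·x_a})_a` has determinant `1` when `∑ x = 0`. [folklore] -/
theorem det_diagonal_exp_neg_mul (x : ι → ℝ) (hx : ∑ a, x a = 0) (s : ℝ) :
    (Matrix.diagonal fun a => ((Real.exp (-(s * x a)) : ℝ) : ℂ)).det = 1 := by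
  rw [Matrix.det_diagonal]
  have h : ∏ a, ((Real.exp (-(s * x a)) : ℝ) : ℂ) = ((∏ a, Real.exp (-(s * x a)) : ℝ) : ℂ) := by
    push_cast; rfl
  rw [h, ← Real.exp_sum]
  have h0 : ∑ a, -(s * x a) = 0 := by
    rw [Finset.sum_neg_distrib, ← Finset.mul_sum, hx, mul_zero, neg_zero]
  rw [h0, Real.exp_zero]; simp

/-- **Separating weights destabilise** (the easy half of the Hilbert–Mumford criterion for
`SL × SL × SL` in torus form, BL §2.3): if real weights `x, y, z` on the three index sets, each of
total sum `0`, satisfy `x a + y b + z c > 0` on the support of `t`, then the diagonal one-parameter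
subgroup `(diag e^{−s x}, diag e^{−s y}, diag e^{−s z}) ∈ SL³` drives `t` to `0` as `s → ∞`, so
`t` is unstable (`0 ∈ cl(SL³·t)`). [cite: BlaserLysikov2020, §2.3] -/
theorem isUnstable_of_sepWeight (t : ι → κ → μ → ℂ) (x : ι → ℝ) (y : κ → ℝ) (z : μ → ℝ)
    (hx : ∑ a, x a = 0) (hy : ∑ b, y b = 0) (hz : ∑ c, z c = 0)
    (hsep : ∀ a b c, t a b c ≠ 0 → 0 < x a + y b + z c) : IsUnstable t := by
  -- the one-parameter family, sampled at `s = n : ℕ`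
  set d₁ : ℕ → ι → ℂ := fun n a => ((Real.exp (-((n : ℝ) * x a)) : ℝ) : ℂ) with hd₁
  set d₂ : ℕ → κ → ℂ := fun n b => ((Real.exp (-((n : ℝ) * y b)) : ℝ) : ℂ) with hd₂
  set d₃ : ℕ → μ → ℂ := fun n c => ((Real.exp (-((n : ℝ) * z c)) : ℝ) : ℂ) with hd₃
  set T : ℕ → ι → κ → μ → ℂ := fun n =>
    actTensor (Matrix.diagonal (d₁ n)) (Matrix.diagonal (d₂ n)) (Matrix.diagonal (d₃ n)) t with hT
  have hmem : ∀ n, T n ∈ Set.range (fun g :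
      Matrix.SpecialLinearGroup ι ℂ × Matrix.SpecialLinearGroup κ ℂ × Matrix.SpecialLinearGroup μ ℂ =>
        actTensor (g.1 : Matrix ι ι ℂ) (g.2.1 : Matrix κ κ ℂ) (g.2.2 : Matrix μ μ ℂ) t) := fun n =>
    ⟨⟨⟨Matrix.diagonal (d₁ n), det_diagonal_exp_neg_mul x hx n⟩,
      ⟨Matrix.diagonal (d₂ n), det_diagonal_exp_neg_mul y hy n⟩,
      ⟨Matrix.diagonal (d₃ n), det_diagonal_exp_neg_mul z hz n⟩⟩, rfl⟩
  have hlim : Tendsto T atTop (𝓝 0) := by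
    rw [tendsto_pi_nhds]; intro a
    rw [tendsto_pi_nhds]; intro b
    rw [tendsto_pi_nhds]; intro c
    have hentry : ∀ n, T n a b c = d₁ n a * d₂ n b * d₃ n c * t a b c := fun n =>
      actTensor_diagonal_apply _ _ _ t a b c
    simp only [hentry, Pi.zero_apply]
    by_cases h0 : t a b c = 0
    · simp only [h0, mul_zero]
      exact tendsto_const_nhds
    · have hw : 0 < x a + y b + z c := hsep a b c h0
      rw [tendsto_zero_iff_norm_tendsto_zero]
      have hnorm : ∀ n, ‖d₁ n a * d₂ n b * d₃ n c * t a b c‖ =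
          Real.exp (-((n : ℝ) * (x a + y b + z c))) * ‖t a b c‖ := by
        intro n
        rw [norm_mul, norm_mul, norm_mul, hd₁, hd₂, hd₃]
        simp only [Complex.norm_real, Real.norm_eq_abs, abs_of_pos (Real.exp_pos _)]
        rw [← Real.exp_add, ← Real.exp_add]
        congr 1; ring_nf
      simp only [hnorm]
      have h1 : Tendsto (fun n : ℕ => -((n : ℝ) * (x a + y b + z c))) atTop atBot :=
        tendsto_neg_atTop_atBot.comp (tendsto_natCast_atTop_atTop.atTop_mul_const hw)
      have h2 := (Real.tendsto_exp_atBot.comp h1).mul_const ‖t a b c‖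
      rw [zero_mul] at h2
      exact h2
  exact mem_closure_of_tendsto hlim (Eventually.of_forall hmem)

/-- Integer form of `isUnstable_of_sepWeight`: integer weights of total sum `0` with
`α a + β b + γ c ≥ 1` on the support of an integer table `T` destabilise the complex tensor
`(T_{abc})`. [folklore] -/
theorem isUnstable_intCast_of_sepWeight (T : ι → κ → μ → ℤ) (α : ι → ℤ) (β : κ → ℤ) (γ : μ → ℤ)
    (hα : ∑ a, α a = 0) (hβ : ∑ b, β b = 0) (hγ : ∑ c, γ c = 0)
    (hsep : ∀ a b c, T a b c ≠ 0 → 1 ≤ α a + β b + γ c) :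
    IsUnstable (fun a b c => (T a b c : ℂ)) := by
  refine isUnstable_of_sepWeight _ (fun a => (α a : ℝ)) (fun b => (β b : ℝ)) (fun c => (γ c : ℝ))
    (by exact_mod_cast hα) (by exact_mod_cast hβ) (by exact_mod_cast hγ) ?_
  intro a b c h
  have h' : T a b c ≠ 0 := fun h0 => h (by simp [h0])
  have := hsep a b c h'
  exact_mod_cast (show (0 : ℤ) < α a + β b + γ c by omega)

end SepWeight

/-! ## Conciseness from dual coordinates -/

section DualCoords

variable {ι κ μ : Type}

/-- If the `a`-slices of an integer table `T` have *dual coordinates* `p i ∈ κ × μ`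
(`T a (p i) = δ_{a i}`), they are linearly independent over `ℂ` (pair a vanishing combination
with the coordinate `p i`). [folklore] -/
theorem linearIndependent_slices₁ [Fintype ι] [DecidableEq ι] (T : ι → κ → μ → ℤ) (p : ι → κ × μ)
    (h : ∀ a i, T a (p i).1 (p i).2 = if a = i then 1 else 0) :
    LinearIndependent ℂ (fun a => fun q : κ × μ => ((T a q.1 q.2 : ℤ) : ℂ)) := by
  rw [Fintype.linearIndependent_iff]
  intro g hg i
  have hgi := congr_fun hg (p i)
  simp only [Finset.sum_apply, Pi.smul_apply, smul_eq_mul, Pi.zero_apply, h] at hgi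
  simpa using hgi

/-- Dual coordinates for the `b`-slices. [folklore] -/
theorem linearIndependent_slices₂ [Fintype κ] [DecidableEq κ] (T : ι → κ → μ → ℤ) (p : κ → ι × μ)
    (h : ∀ b i, T (p i).1 b (p i).2 = if b = i then 1 else 0) :
    LinearIndependent ℂ (fun b => fun q : ι × μ => ((T q.1 b q.2 : ℤ) : ℂ)) := by
  rw [Fintype.linearIndependent_iff]
  intro g hg i
  have hgi := congr_fun hg (p i)
  simp only [Finset.sum_apply, Pi.smul_apply, smul_eq_mul, Pi.zero_apply, h] at hgi
  simpa using hgi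

/-- Dual coordinates for the `c`-slices. [folklore] -/
theorem linearIndependent_slices₃ [Fintype μ] [DecidableEq μ] (T : ι → κ → μ → ℤ) (p : μ → ι × κ)
    (h : ∀ c i, T (p i).1 (p i).2 c = if c = i then 1 else 0) :
    LinearIndependent ℂ (fun c => fun q : ι × κ => ((T q.1 q.2 c : ℤ) : ℂ)) := by
  rw [Fintype.linearIndependent_iff]
  intro g hg i
  have hgi := congr_fun hg (p i)
  simp only [Finset.sum_apply, Pi.smul_apply, smul_eq_mul, Pi.zero_apply, h] at hgi
  simpa using hgi

/-- **Conciseness from dual coordinates**: an integer table whose three slice families admit dual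
coordinates is concise as a complex tensor. [folklore] -/
theorem isConcise_intCast_of_dualCoords [Fintype ι] [Fintype κ] [Fintype μ] [DecidableEq ι]
    [DecidableEq κ] [DecidableEq μ] (T : ι → κ → μ → ℤ) (p₁ : ι → κ × μ) (p₂ : κ → ι × μ)
    (p₃ : μ → ι × κ)
    (h₁ : ∀ a i, T a (p₁ i).1 (p₁ i).2 = if a = i then 1 else 0)
    (h₂ : ∀ b i, T (p₂ i).1 b (p₂ i).2 = if b = i then 1 else 0)
    (h₃ : ∀ c i, T (p₃ i).1 (p₃ i).2 c = if c = i then 1 else 0) :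
    IsConcise (fun a b c => ((T a b c : ℤ) : ℂ)) :=
  ⟨linearIndependent_slices₁ T p₁ h₁, linearIndependent_slices₂ T p₂ h₂,
    linearIndependent_slices₃ T p₃ h₃⟩

end DualCoords

/-! ## The five tensors of Jelisiejew–Landsberg–Pal, Thm. 1.6 -/

section JLP

/-- The elementary integer tensor `e_a ⊗ e_b ⊗ e_c` on `Fin 5 × Fin 5 × Fin 5`. [folklore] -/
def e5 (a b c : Fin 5) : Fin 5 → Fin 5 → Fin 5 → ℤ :=
  fun i j k => if i = a ∧ j = b ∧ k = c then 1 else 0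

/-- `T_{M1} = a₁⊗(b₁⊗c₁+b₂⊗c₂+b₃⊗c₃+b₄⊗c₄) + a₂⊗b₃⊗c₁ + a₃⊗b₄⊗c₁ + a₄⊗b₄⊗c₂ + a₅⊗(b₅⊗c₁+b₄⊗c₅)`
(JLP, display after Thm. 1.6; indices shifted to `0 … 4`). [cite: JelisiejewLandsbergPal2023, Thm. 1.6] -/
def jlpM1 : Fin 5 → Fin 5 → Fin 5 → ℤ :=
  e5 0 0 0 + e5 0 1 1 + e5 0 2 2 + e5 0 3 3 + e5 1 2 0 + e5 2 3 0 + e5 3 3 1 + e5 4 4 0 + e5 4 3 4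

/-- `T_{M2} = a₁⊗(b₁⊗c₁+⋯+b₄⊗c₄) + a₂⊗(b₃⊗c₁ − b₄⊗c₂) + a₃⊗b₄⊗c₁ + a₄⊗b₃⊗c₂ + a₅⊗(b₅⊗c₁+b₄⊗c₅)`
(indices shifted to `0 … 4`). [cite: JelisiejewLandsbergPal2023, Thm. 1.6] -/
def jlpM2 : Fin 5 → Fin 5 → Fin 5 → ℤ :=
  e5 0 0 0 + e5 0 1 1 + e5 0 2 2 + e5 0 3 3 + e5 1 2 0 - e5 1 3 1 + e5 2 3 0 + e5 3 2 1 +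
    e5 4 4 0 + e5 4 3 4

/-- `T_{𝒪₅₈} = T_{M2} + a₅⊗(b₁⊗c₂ − b₃⊗c₄)` — after a change of bases the unique symmetric tensor of
the list, with stabiliser containing `GL₂(ℂ)`. [cite: JelisiejewLandsbergPal2023, Thm. 1.6] -/
def jlpO58 : Fin 5 → Fin 5 → Fin 5 → ℤ := jlpM2 + e5 4 0 1 - e5 4 2 3

/-- `T_{𝒪₅₇} = T_{M2}`. [cite: JelisiejewLandsbergPal2023, Thm. 1.6] -/
def jlpO57 : Fin 5 → Fin 5 → Fin 5 → ℤ := jlpM2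

/-- `T_{𝒪₅₆} = T_{M1} + a₅⊗b₂⊗c₂`. [cite: JelisiejewLandsbergPal2023, Thm. 1.6] -/
def jlpO56 : Fin 5 → Fin 5 → Fin 5 → ℤ := jlpM1 + e5 4 1 1

/-- `T_{𝒪₅₅} = T_{M1} + a₅⊗b₃⊗c₂`. [cite: JelisiejewLandsbergPal2023, Thm. 1.6] -/
def jlpO55 : Fin 5 → Fin 5 → Fin 5 → ℤ := jlpM1 + e5 4 2 1

/-- `T_{𝒪₅₄} = T_{M1}`. [cite: JelisiejewLandsbergPal2023, Thm. 1.6] -/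
def jlpO54 : Fin 5 → Fin 5 → Fin 5 → ℤ := jlpM1

/-! ### Instability: two explicit destabilising one-parameter subgroups -/

/-- `T_{𝒪₅₈}` is unstable: the weights `W₁ = ((8,−2,−2,−2,−2), (0,−10,5,5,0), (3,3,−2,−2,−2))`,
each of sum `0`, have `α_a + β_b + γ_c ≥ 1` on its twelve support triples (checked by `decide +kernel`).
[folklore] -/
theorem isUnstable_jlpO58 : IsUnstable (fun a b c => (jlpO58 a b c : ℂ)) :=
  isUnstable_intCast_of_sepWeight _ ![8, -2, -2, -2, -2] ![0, -10, 5, 5, 0] ![3, 3, -2, -2, -2]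
    (by decide +kernel) (by decide +kernel) (by decide +kernel) (by decide +kernel)

/-- `T_{𝒪₅₇} = T_{M2}` is unstable (weights `W₁`, its support being contained in that of `T_{𝒪₅₈}`).
[folklore] -/
theorem isUnstable_jlpO57 : IsUnstable (fun a b c => (jlpO57 a b c : ℂ)) :=
  isUnstable_intCast_of_sepWeight _ ![8, -2, -2, -2, -2] ![0, -10, 5, 5, 0] ![3, 3, -2, -2, -2]
    (by decide +kernel) (by decide +kernel) (by decide +kernel) (by decide +kernel)

/-- `T_{𝒪₅₆}` is unstable: weights `W₂ = ((4,−1,−1,−1,−1), (−5,0,0,4,1), (2,2,−1,−1,−2))`.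
[folklore] -/
theorem isUnstable_jlpO56 : IsUnstable (fun a b c => (jlpO56 a b c : ℂ)) :=
  isUnstable_intCast_of_sepWeight _ ![4, -1, -1, -1, -1] ![-5, 0, 0, 4, 1] ![2, 2, -1, -1, -2]
    (by decide +kernel) (by decide +kernel) (by decide +kernel) (by decide +kernel)

/-- `T_{𝒪₅₅}` is unstable (weights `W₂`). [folklore] -/
theorem isUnstable_jlpO55 : IsUnstable (fun a b c => (jlpO55 a b c : ℂ)) :=
  isUnstable_intCast_of_sepWeight _ ![4, -1, -1, -1, -1] ![-5, 0, 0, 4, 1] ![2, 2, -1, -1, -2]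
    (by decide +kernel) (by decide +kernel) (by decide +kernel) (by decide +kernel)

/-- `T_{𝒪₅₄} = T_{M1}` is unstable (weights `W₂`). [folklore] -/
theorem isUnstable_jlpO54 : IsUnstable (fun a b c => (jlpO54 a b c : ℂ)) :=
  isUnstable_intCast_of_sepWeight _ ![4, -1, -1, -1, -1] ![-5, 0, 0, 4, 1] ![2, 2, -1, -1, -2]
    (by decide +kernel) (by decide +kernel) (by decide +kernel) (by decide +kernel)

/-! ### Conciseness: dual coordinates for the three slice families -/

/-- Dual coordinates `(b,c)` for the `a`-slices of the `T_{M2}`-family (`𝒪₅₈, 𝒪₅₇`):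
printed `(1,1),(3,1),(4,1),(3,2),(5,1)`. [folklore] -/
def dualA2 : Fin 5 → Fin 5 × Fin 5 := ![(0, 0), (2, 0), (3, 0), (2, 1), (4, 0)]

/-- Dual coordinates `(b,c)` for the `a`-slices of the `T_{M1}`-family (`𝒪₅₆, 𝒪₅₅, 𝒪₅₄`):
printed `(1,1),(3,1),(4,1),(4,2),(5,1)`. [folklore] -/
def dualA1 : Fin 5 → Fin 5 × Fin 5 := ![(0, 0), (2, 0), (3, 0), (3, 1), (4, 0)]

/-- Dual coordinates `(a,c)` for the `b`-slices of all five tensors: printed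
`(1,1),(1,2),(1,3),(1,4),(5,1)`. [folklore] -/
def dualB : Fin 5 → Fin 5 × Fin 5 := ![(0, 0), (0, 1), (0, 2), (0, 3), (4, 0)]

/-- Dual coordinates `(a,b)` for the `c`-slices of all five tensors: printed
`(1,1),(1,2),(1,3),(1,4),(5,4)`. [folklore] -/
def dualC : Fin 5 → Fin 5 × Fin 5 := ![(0, 0), (0, 1), (0, 2), (0, 3), (4, 3)]

/-- `T_{𝒪₅₈}` is concise. [folklore] -/
theorem isConcise_jlpO58 : IsConcise (fun a b c => (jlpO58 a b c : ℂ)) :=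
  isConcise_intCast_of_dualCoords jlpO58 dualA2 dualB dualC (by decide +kernel) (by decide +kernel)
    (by decide +kernel)

/-- `T_{𝒪₅₇}` is concise. [folklore] -/
theorem isConcise_jlpO57 : IsConcise (fun a b c => (jlpO57 a b c : ℂ)) :=
  isConcise_intCast_of_dualCoords jlpO57 dualA2 dualB dualC (by decide +kernel) (by decide +kernel)
    (by decide +kernel)

/-- `T_{𝒪₅₆}` is concise. [folklore] -/
theorem isConcise_jlpO56 : IsConcise (fun a b c => (jlpO56 a b c : ℂ)) :=
  isConcise_intCast_of_dualCoords jlpO56 dualA1 dualB dualC (by decide +kernel) (by decide +kernel)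
    (by decide +kernel)

/-- `T_{𝒪₅₅}` is concise. [folklore] -/
theorem isConcise_jlpO55 : IsConcise (fun a b c => (jlpO55 a b c : ℂ)) :=
  isConcise_intCast_of_dualCoords jlpO55 dualA1 dualB dualC (by decide +kernel) (by decide +kernel)
    (by decide +kernel)

/-- `T_{𝒪₅₄}` is concise. [folklore] -/
theorem isConcise_jlpO54 : IsConcise (fun a b c => (jlpO54 a b c : ℂ)) :=
  isConcise_intCast_of_dualCoords jlpO54 dualA1 dualB dualC (by decide +kernel) (by decide +kernel)
    (by decide +kernel)

/-! ### The barrier bites -/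

/-- The five tensors of JLP Thm. 1.6 are unstable and concise. [folklore] -/
theorem jlp_five_unstable_concise :
    ∀ T ∈ [jlpO58, jlpO57, jlpO56, jlpO55, jlpO54],
      IsUnstable (fun a b c => (T a b c : ℂ)) ∧ IsConcise (fun a b c => (T a b c : ℂ)) := by
  intro T hT
  simp only [List.mem_cons, List.not_mem_nil, or_false] at hT
  rcases hT with rfl | rfl | rfl | rfl | rfl
  exacts [⟨isUnstable_jlpO58, isConcise_jlpO58⟩, ⟨isUnstable_jlpO57, isConcise_jlpO57⟩,
    ⟨isUnstable_jlpO56, isConcise_jlpO56⟩, ⟨isUnstable_jlpO55, isConcise_jlpO55⟩,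
    ⟨isUnstable_jlpO54, isConcise_jlpO54⟩]

/-- Bläser–Lysikov Thm. 17 (proved in the tree) at `n = 5`: for every unstable concise
`t ∈ ℂ^{5×5×5}`, `(1 − 3⁻¹⁵/(18·5⁴·ln 5))⁻¹ · log Q̃(t) ≤ log R̃(t)`. [cite: BlaserLysikov2020, Thm. 17] -/
theorem blaserLysikov_thm17_five {t : Fin 5 → Fin 5 → Fin 5 → ℂ} (hu : IsUnstable t)
    (hc : IsConcise t) :
    (1 - (3 : ℝ) ^ (-(3 * (5 : ℝ))) / (18 * (5 : ℝ) ^ 4 * Real.log 5))⁻¹ *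
        Real.log (asymptoticSubrank ℂ t) ≤ Real.log (asymptoticRank t) := by
  have h := BlaserLysikov2020_thm17_holds (ι := Fin 5) (κ := Fin 5) (μ := Fin 5) 5 (by norm_num)
    (Fintype.card_fin 5) (Fintype.card_fin 5) (Fintype.card_fin 5) t hu hc
  exact_mod_cast h

/-- **The unstable-tensor barrier bites the `1`-degenerate minimal-border-rank tensors of
`ℂ⁵ ⊗ ℂ⁵ ⊗ ℂ⁵`.** For each of the five tensors `T` of JLP Thm. 1.6,
`B₁₇(5) · log Q̃(T) ≤ log R̃(T)` with `B₁₇(5) = (1 − 3⁻¹⁵/(18·5⁴·ln 5))⁻¹ > 1`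
(`one_lt_blaserLysikovBound`), i.e. `i(T) ≥ B₁₇(5) > 1`; by BL Thm. 7 (= CVZ Thm. 9) arbitrary
restrictions from powers of `T` certify no bound `ω < 2 B₁₇(5)`, in particular not `ω = 2` — these
tensors do not evade the barrier, contrary to the expectation recorded in JLP §1.4.8.
[cite: JelisiejewLandsbergPal2023, §1.4.8] -/
theorem jlp_five_barrier :
    ∀ T ∈ [jlpO58, jlpO57, jlpO56, jlpO55, jlpO54],
      (1 - (3 : ℝ) ^ (-(3 * (5 : ℝ))) / (18 * (5 : ℝ) ^ 4 * Real.log 5))⁻¹ *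
          Real.log (asymptoticSubrank ℂ (fun a b c => (T a b c : ℂ))) ≤
        Real.log (asymptoticRank (fun a b c => (T a b c : ℂ))) := fun T hT =>
  blaserLysikov_thm17_five (jlp_five_unstable_concise T hT).1 (jlp_five_unstable_concise T hT).2

end JLP

end Literature.Barriers.MatrixMultiplication

end
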